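import Mathlib
import HarnessLib

/-!
# Route `HolmgrenBoyleLind`: Lennard-Jones force fields of separated sources, part 21a —
separated sequences of positive upper density are non-Blaschke

Support file for the crux item stmt-AtomisticToContinuum-6075 (`HalfSpaceUniqueContinuation`, line
`registered`, layered core, THICK COLUMNS FROM FINITELY MANY REGISTRIES; infrastructure written by a
stub-worker of lead c3). Pure real analysis, no geometry.

* **`hbl_not_summable_inv_of_upperDensity'`** (+ registered `∀`-form
  `hbl_not_summable_inv_of_upperDensity`) — if `t : ℕ → ℝ`, `t n ≥ 1`, is `δ`-separated
  (`|t m − t n| ≥ δ` for `m ≠ n`) and has positive upper density (`d T ≤ #{n | t n ≤ T}` for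
  arbitrarily large `T`), then `∑ 1/tₙ = ∞`. Proof: along a sparse subsequence of good radii
  `T_{j+1} ≥ (4/(dδ)) T_j` the block `T_j < t n ≤ T_{j+1}` holds at least `d T_{j+1} − T_j/δ − 1
  ≥ d T_{j+1}/2` indices (separation bounds the count below `T_j` by `T_j/δ + 1`), each contributing
  `≥ 1/T_{j+1}`, so every block adds `≥ d/2` to the series (Cauchy criterion fails).
All `[folklore]`; nothing here closes an item.
-/

noncomputable section

namespace Summit.AtomisticToContinuum.Crystallization.Theorems.HolmgrenBoyleLind

open scoped BigOperators Topology
open Filter Set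

/-- **Separated sequences of positive upper density are non-Blaschke.** [folklore] -/
theorem hbl_not_summable_inv_of_upperDensity' {t : ℕ → ℝ} {δ d : ℝ} (hδ : 0 < δ) (hd : 0 < d)
    (ht : ∀ n, 1 ≤ t n) (hsep : ∀ m n, m ≠ n → δ ≤ |t m - t n|)
    (hdense : ∀ T₀ : ℝ, ∃ T : ℝ, T₀ ≤ T ∧ d * T ≤ ({n : ℕ | t n ≤ T}.ncard : ℝ)) :
    ¬ Summable (fun n => (t n)⁻¹) := by
  intro hsum
  have htpos : ∀ n, 0 < t n := fun n => one_pos.trans_le (ht n)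
  -- (1) separation: `n ↦ ⌊t n / δ⌋₊` is injective, so every sublevel set `{n | t n ≤ T}` is finite.
  have hinj : Function.Injective fun n => ⌊t n / δ⌋₊ := by
    intro m n hmn
    by_contra hne
    have hmn' : (⌊t m / δ⌋₊ : ℝ) = ⌊t n / δ⌋₊ := by exact_mod_cast hmn
    have h1 : (⌊t m / δ⌋₊ : ℝ) ≤ t m / δ := Nat.floor_le (div_nonneg (htpos m).le hδ.le)
    have h2 : t m / δ < ⌊t m / δ⌋₊ + 1 := Nat.lt_floor_add_one _
    have h3 : (⌊t n / δ⌋₊ : ℝ) ≤ t n / δ := Nat.floor_le (div_nonneg (htpos n).le hδ.le)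
    have h4 : t n / δ < ⌊t n / δ⌋₊ + 1 := Nat.lt_floor_add_one _
    have h5 : |t m / δ - t n / δ| < 1 := by
      rw [abs_sub_lt_iff]
      constructor <;> linarith
    rw [← sub_div, abs_div, abs_of_pos hδ, div_lt_one hδ] at h5
    exact absurd (hsep m n hne) (not_le.mpr h5)
  have hfin : ∀ T : ℝ, {n : ℕ | t n ≤ T}.Finite := by
    intro T
    refine ((Set.finite_Iic ⌊T / δ⌋₊).preimage hinj.injOn).subset fun n hn => ?_
    have hn' : t n ≤ T := hn
    exact Nat.floor_le_floor (div_le_div_of_nonneg_right hn' hδ.le)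
  -- (2) Cauchy tail: beyond a finite index set `s`, every finite partial sum is `< d / 2`.
  obtain ⟨s, hs⟩ := hsum.vanishing (Iio_mem_nhds (half_pos hd))
  -- (3) a radius `Ta ≥ 1` above the depths indexed by `s`, and the finite index set `A` below it.
  obtain ⟨Ta, hTa1, hTas⟩ : ∃ Ta : ℝ, 1 ≤ Ta ∧ ∀ n ∈ s, t n < Ta := by
    refine ⟨1 + ∑ n ∈ s, t n, ?_, fun n hn => ?_⟩
    · have h0 : 0 ≤ ∑ n ∈ s, t n := Finset.sum_nonneg fun m _ => (htpos m).le
      linarith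
    · have h0 : t n ≤ ∑ m ∈ s, t m := Finset.single_le_sum (fun m _ => (htpos m).le) hn
      linarith
  obtain ⟨A, hA⟩ : ∃ A : Finset ℕ, ∀ n, n ∈ A ↔ t n ≤ Ta :=
    ⟨(hfin Ta).toFinset, fun n => by simp⟩
  -- (4) a good radius `Tb ≥ max Ta (2 #A / d)` with `d Tb ≤ #{n | t n ≤ Tb} = #Bf`.
  obtain ⟨Tb, hTb, hdensb⟩ := hdense (max Ta (2 * (A.card : ℝ) / d))
  have hTab : Ta ≤ Tb := (le_max_left _ _).trans hTb
  have hTb_pos : 0 < Tb := by linarith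
  have h2A : 2 * (A.card : ℝ) ≤ Tb * d := (div_le_iff₀ hd).mp ((le_max_right _ _).trans hTb)
  obtain ⟨Bf, hBf⟩ : ∃ Bf : Finset ℕ, ∀ n, n ∈ Bf ↔ t n ≤ Tb :=
    ⟨(hfin Tb).toFinset, fun n => by simp⟩
  have hset : {n : ℕ | t n ≤ Tb} = (Bf : Set ℕ) := by
    ext n
    simp [hBf]
  have hNb : d * Tb ≤ (Bf.card : ℝ) := by simpa [hset] using hdensb
  -- (5) the block `Bf \ A = {n | Ta < t n ≤ Tb}` avoids `s` and has `≥ #Bf - #A ≥ d Tb / 2` indices,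
  -- each contributing `≥ 1 / Tb`; so its partial sum is `≥ d / 2`, a contradiction.
  have hdisj : Disjoint (Bf \ A) s := by
    rw [Finset.disjoint_left]
    intro n hn hns
    rw [Finset.mem_sdiff, hA] at hn
    exact hn.2 (hTas n hns).le
  have hcard : (Bf.card : ℝ) ≤ ((Bf \ A).card : ℝ) + (A.card : ℝ) := by
    exact_mod_cast Finset.card_le_card_sdiff_add_card
  have hblock : ((Bf \ A).card : ℝ) ≤ Tb * ∑ n ∈ Bf \ A, (t n)⁻¹ := by
    rw [Finset.mul_sum]
    have h := Finset.card_nsmul_le_sum (Bf \ A) (fun n => Tb * (t n)⁻¹) 1 fun n hn => ?_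
    · simpa using h
    · have hnb : t n ≤ Tb := (hBf n).mp (Finset.mem_sdiff.mp hn).1
      rw [← div_eq_mul_inv, one_le_div (htpos n)]
      exact hnb
  have hlt : ∑ n ∈ Bf \ A, (t n)⁻¹ < d / 2 := Set.mem_Iio.mp (hs _ hdisj)
  have hlt' : Tb * ∑ n ∈ Bf \ A, (t n)⁻¹ < Tb * (d / 2) := mul_lt_mul_of_pos_left hlt hTb_pos
  linarith

/-- **Separated sequences of positive upper density are non-Blaschke** (registered `∀`-form of
`hbl_not_summable_inv_of_upperDensity'`). [folklore] -/
theorem hbl_not_summable_inv_of_upperDensity : ∀ {t : ℕ → ℝ} {δ d : ℝ}, 0 < δ → 0 < d → (∀ n : ℕ, 1 ≤ t n) → (∀ m n : ℕ, m ≠ n → δ ≤ |t m - t n|) → (∀ T₀ : ℝ, ∃ T : ℝ, T₀ ≤ T ∧ d * T ≤ (({n : ℕ | t n ≤ T} : Set ℕ).ncard : ℝ)) → ¬ Summable (fun n : ℕ => (t n)⁻¹) := by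
  intro t δ d hδ hd ht hsep hdense
  exact hbl_not_summable_inv_of_upperDensity' hδ hd ht hsep hdense

end Summit.AtomisticToContinuum.Crystallization.Theorems.HolmgrenBoyleLind

end
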